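import Literature.NumberTheory.EllipticCurves.ZpExtensionScalarTwistResidualQuotient
import Literature.NumberTheory.EllipticCurves.IwasawaAlgebraEisensteinFiniteQuotientSpanProofs
import Literature.NumberTheory.EllipticCurves.ZpExtensionEisensteinTwistDualityForm
import Literature.NumberTheory.EllipticCurves.IwasawaAlgebraInvolution
import HarnessLib

/-!
# The bottom Eisenstein level `W₁ = M ⊗ A_{m,1}(ψ)`: `T`-torsion structure and the `G_ℚ`-structure `τ ⊗ ι`
# (theorems only)

`Proofs` file (theorems only; no definition, no named fact, no instance, no `sorry`).  Topic
`NumberTheory/EllipticCurves` (D1 road of cell `pub/bsd-print-x9`; Howard's hypothesis **H.5(b)** for the Eisenstein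
specialisation at the places of `S`, memo `HOME/x9-p1-w3/H5B-AT-S-PLAN-w3g5.md`, step (A1)).

The bottom level of Howard's tower `T_𝔮/p T_𝔮 = M ⊗ A_{m,1}(ψ)` has the CHARACTERISTIC-`p` coefficient ring
`A_{m,1} = Λ/(T^m + p, p) = 𝔽_p[T]/(T^m)`.  Two facts about it drive H.5(b) at the places `v ∈ S`:

* §1–§2 (the `T`-adic structure): `[T]^m = 0` in `A_{m,1}`; an element killed by `[T]^{m-1}` lies in `([T])`
  (`exists_eq_mk_X_mul_of_pow_pred_mul_eq_zero`, read off the coefficient of `T^{m-1}`), and — `M ⊗ A_{m,1}` being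
  free over `A_{m,1}` when `M ≃ (ℤ/p)^ι` (`Twisted.basisOfAddEquiv`, H.0) — a vector killed by `[T]^{m-1}` lies in
  `[T] · (M ⊗ A_{m,1})` (`Twisted.exists_eq_mk_X_smul_of_pow_pred_smul_eq_zero`).
* §3–§4 (the `G_ℚ`-structure): the Iwasawa involution `ι : T ↦ (1+T)⁻¹ − 1` (`IwasawaAlgebra.invol`) DESCENDS to
  `A_{m,1}` (it does not descend to `A_{m,j}`, `j ≥ 2`: `ι(T^m + p) ∉ (T^m + p, p^j)`), and for a discrete `Γ_K`-module
  `M` with an additive `θ : M → M` intertwining the `τ`-conjugate action (`θ ∘ ρ(c g) = ρ(g) ∘ θ`, e.g. `τ` on `E[p]`,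
  `E/ℚ`) and an ANTICYCLOTOMIC `κ` (`κ(c g) = −κ(g)`), the map `Θ = (−1)^{m-1} · (ι ⊗ θ)` of `M ⊗ A_{m,1}(ψ)`
  intertwines the `τ`-conjugate of Howard's twisted action with the twisted action — the `G_ℚ`-structure of the bottom
  level extending `θ` on `T̄` (`ZpExtension.exists_bottomConj`: existence with the four properties used downstream —
  `c`-equivariance, involutivity, `Θ([T]^{m-1} • x) = (−1)^{m-1} [T]^{m-1} • Θ x`, and the value on pure tensors through
  a lift `ι₁` of `ι` preserving the residue character).

References: [Howard2004HeegnerKolyvagin] B. Howard, Compositio Math. 140 (2004), §1.3 H.5, §2.2 and proof of Thm. 2.2.10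
(arXiv:1202.6340 p. 7 L93–97, p. 12); [Washington1997] §7.1, §13.2; [MazurTateTeitelbaum1986Invent] Ch. I §17 (the
involution). BSD is not proved by any of this.
-/

noncomputable section

open scoped TensorProduct
open Function

namespace Literature.NumberTheory.EllipticCurves

/-! ## §1 The `T`-adic structure of `A_{m,1} = 𝔽_p[T]/(T^m)` -/

namespace IwasawaAlgebra.EisensteinCoeff

variable (p : ℕ) [hp : Fact p.Prime]

/-- `[T]^m = 0` in `A_{m,1}` (`T^m = −p` and `p = 0`). [cite: Howard2004HeegnerKolyvagin, proof of Thm. 2.2.10 (𝔮 = T^m + p)] -/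
theorem mk_X_pow_eq_zero (m : ℕ) :
    (Ideal.Quotient.mk _ PowerSeries.X : EisensteinCoeff p m 1) ^ m = 0 := by
  rw [← map_pow, Ideal.Quotient.eq_zero_iff_mem]
  simpa only [mul_one] using X_pow_mul_mem_span_qm_sup_span_C_pow p m 1

/-- In `A_{m,1}` every multiple of `[T]` by a unit `1 + [T]·a` has the same powers from `m-1` on:
`[T]^{m-1} * [T] = 0`. [cite: Howard2004HeegnerKolyvagin, proof of Thm. 2.2.10 (𝔮 = T^m + p)] -/
theorem mk_X_pow_pred_mul_mk_X {m : ℕ} (hm : 1 ≤ m) :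
    (Ideal.Quotient.mk _ PowerSeries.X : EisensteinCoeff p m 1) ^ (m - 1) * Ideal.Quotient.mk _ PowerSeries.X = 0 := by
  rw [← pow_succ, Nat.sub_add_cancel hm, mk_X_pow_eq_zero]

/-- The coefficient of `T^{m-1}` of an element of the ideal `(T^m + p, p)` of `Λ` is divisible by `p` (`m ≥ 1`).
[cite: Washington1997, §7.1 (Λ = ℤ_p[[T]], division with remainder)] -/
theorem dvd_coeff_pred_of_mem {m : ℕ} (hm : 1 ≤ m) {a : IwasawaAlgebra p}
    (ha : a ∈ Ideal.span {(PowerSeries.X ^ m + PowerSeries.C (p : ℤ_[p]) : IwasawaAlgebra p)} ⊔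
      Ideal.span {PowerSeries.C ((p : ℤ_[p]) ^ 1)}) :
    (p : ℤ_[p]) ∣ PowerSeries.coeff (m - 1) a := by
  obtain ⟨y, hy, z, hz, rfl⟩ := Submodule.mem_sup.mp ha
  obtain ⟨b, rfl⟩ := Ideal.mem_span_singleton'.mp hy
  obtain ⟨d, rfl⟩ := Ideal.mem_span_singleton'.mp hz
  have h1 : PowerSeries.coeff (m - 1) (b * (PowerSeries.X ^ m + PowerSeries.C (p : ℤ_[p]))) =
      (p : ℤ_[p]) * PowerSeries.coeff (m - 1) b := by
    rw [mul_add, map_add, mul_comm b (PowerSeries.X ^ m), PowerSeries.coeff_X_pow_mul', if_neg (by omega), zero_add,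
      mul_comm b, PowerSeries.coeff_C_mul]
  have h2 : PowerSeries.coeff (m - 1) (d * PowerSeries.C ((p : ℤ_[p]) ^ 1)) = (p : ℤ_[p]) * PowerSeries.coeff (m - 1) d := by
    rw [pow_one, mul_comm d, PowerSeries.coeff_C_mul]
  rw [map_add, h1, h2]
  exact (Dvd.intro _ rfl).add (Dvd.intro _ rfl)

/-- **An element of `A_{m,1}` killed by `[T]^{m-1}` has residue `0`** (the coefficient of `T^{m-1}` in `T^{m-1} G` is
`G(0)`). [cite: Washington1997, §7.1] [cite: Howard2004HeegnerKolyvagin, proof of Prop. 2.1.3 (S_𝔭/𝔪)] -/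
theorem residueChar_eq_zero_of_pow_pred_mul_eq_zero {m : ℕ} (hm : 1 ≤ m) (c : EisensteinCoeff p m 1)
    (hc : (Ideal.Quotient.mk _ PowerSeries.X : EisensteinCoeff p m 1) ^ (m - 1) * c = 0) :
    residueChar p hm (le_refl 1) c = 0 := by
  obtain ⟨G, rfl⟩ := Ideal.Quotient.mk_surjective c
  rw [← map_pow, ← map_mul, Ideal.Quotient.eq_zero_iff_mem] at hc
  have hdvd := dvd_coeff_pred_of_mem p hm hc
  rw [PowerSeries.coeff_X_pow_mul', if_pos le_rfl, Nat.sub_self, PowerSeries.coeff_zero_eq_constantCoeff] at hdvd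
  rw [residueChar_mk]
  have hker : PowerSeries.constantCoeff G ∈ RingHom.ker (PadicInt.toZMod (p := p)) := by
    rw [PadicInt.ker_toZMod, PadicInt.maximalIdeal_eq_span_p, Ideal.mem_span_singleton]
    exact hdvd
  exact hker

/-- **`ker ([T]^{m-1} ·) ⊆ ([T])` in `A_{m,1}`**: an element killed by `[T]^{m-1}` is a multiple of `[T]`
(`ker ε = ([T])`, `ker_residueChar`). [cite: Washington1997, §7.1] [cite: Howard2004HeegnerKolyvagin, proof of Prop. 2.1.3] -/
theorem exists_eq_mk_X_mul_of_pow_pred_mul_eq_zero {m : ℕ} (hm : 1 ≤ m) (c : EisensteinCoeff p m 1)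
    (hc : (Ideal.Quotient.mk _ PowerSeries.X : EisensteinCoeff p m 1) ^ (m - 1) * c = 0) :
    ∃ d : EisensteinCoeff p m 1, c = Ideal.Quotient.mk _ PowerSeries.X * d := by
  have hmem : c ∈ RingHom.ker (residueChar p hm (le_refl 1)) := residueChar_eq_zero_of_pow_pred_mul_eq_zero p hm c hc
  rw [ker_residueChar, Ideal.mem_span_singleton'] at hmem
  obtain ⟨d, rfl⟩ := hmem
  exact ⟨d, mul_comm _ _⟩

/-! ## §2 The bottom level `M ⊗ A_{m,1}` is `T`-adically exact: `ker [T]^{m-1} ⊆ [T] · (M ⊗ A_{m,1})` -/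

variable {p} {M : Type} [AddCommGroup M] {ι : Type} [Fintype ι]

/-- **A vector of `M ⊗ A_{m,1}` killed by `[T]^{m-1}` is a `[T]`-multiple**, when `M ≃ (ℤ/p)^ι` additively (the level
is then FREE over `A_{m,1}` with the basis `Twisted.basisOfAddEquiv`, hypothesis H.0, and one reads the claim off the
coordinates). [cite: Howard2004HeegnerKolyvagin, §1.3 H.0 and proof of Thm. 2.2.10 (arXiv:1202.6340 p. 7, p. 12)] -/
theorem Twisted.exists_eq_mk_X_smul_of_pow_pred_smul_eq_zero {m : ℕ} (hm : 1 ≤ m) (e : M ≃+ (ι → ZMod (p ^ 1)))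
    (x : Twisted p m 1 M)
    (hx : ((Ideal.Quotient.mk _ PowerSeries.X : EisensteinCoeff p m 1) ^ (m - 1)) • x = 0) :
    ∃ y : Twisted p m 1 M, x = (Ideal.Quotient.mk _ PowerSeries.X : EisensteinCoeff p m 1) • y := by
  classical
  set b := Twisted.basisOfAddEquiv (m := m) e with hb
  have hcoord : ∀ i, (Ideal.Quotient.mk _ PowerSeries.X : EisensteinCoeff p m 1) ^ (m - 1) * b.repr x i = 0 := by
    intro i
    have h := congrArg (fun z ↦ b.repr z i) hx
    simpa only [map_smul, Finsupp.smul_apply, smul_eq_mul, map_zero, Finsupp.zero_apply] using h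
  choose d hd using fun i ↦ exists_eq_mk_X_mul_of_pow_pred_mul_eq_zero p hm (b.repr x i) (hcoord i)
  refine ⟨∑ i, d i • b i, ?_⟩
  rw [Finset.smul_sum]
  conv_lhs => rw [← b.sum_repr x]
  refine Finset.sum_congr rfl fun i _ ↦ ?_
  rw [smul_smul, ← hd i]

/-! ## §3 The Iwasawa involution descends to `A_{m,1}` -/

variable (p)

/-- **`ι` preserves the ideal `(T^m + p, p)`** (`ι(T) = T · g`, so `ι(T^m + p) = T^m g^m + p ∈ (T^m + p, p)`; `ι` fixes
constants).  (It does NOT preserve `(T^m + p, p^j)` for `j ≥ 2`.) [cite: MazurTateTeitelbaum1986Invent, Ch. I §17 (the involution)]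
[cite: Howard2004HeegnerKolyvagin, proof of Thm. 2.2.10 (𝔮 = T^m + p)] -/
theorem invol_mem_of_mem (m : ℕ) {a : IwasawaAlgebra p}
    (ha : a ∈ Ideal.span {(PowerSeries.X ^ m + PowerSeries.C (p : ℤ_[p]) : IwasawaAlgebra p)} ⊔
      Ideal.span {PowerSeries.C ((p : ℤ_[p]) ^ 1)}) :
    invol p a ∈ Ideal.span {(PowerSeries.X ^ m + PowerSeries.C (p : ℤ_[p]) : IwasawaAlgebra p)} ⊔
      Ideal.span {PowerSeries.C ((p : ℤ_[p]) ^ 1)} := by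
  obtain ⟨y, hy, z, hz, rfl⟩ := Submodule.mem_sup.mp ha
  obtain ⟨b, rfl⟩ := Ideal.mem_span_singleton'.mp hy
  obtain ⟨d, rfl⟩ := Ideal.mem_span_singleton'.mp hz
  -- `ι T = T g`
  obtain ⟨g, hg⟩ : PowerSeries.X ∣ invol p PowerSeries.X := by
    rw [invol_X, PowerSeries.X_dvd_iff]
    exact constantCoeff_invSubOne p
  have hι : invol p (b * (PowerSeries.X ^ m + PowerSeries.C (p : ℤ_[p])) + d * PowerSeries.C ((p : ℤ_[p]) ^ 1)) =
      (invol p b * g ^ m) * (PowerSeries.X ^ m + PowerSeries.C (p : ℤ_[p])) +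
        (invol p b * (1 - g ^ m) + invol p d) * PowerSeries.C ((p : ℤ_[p]) ^ 1) := by
    rw [map_add, map_mul, map_mul, map_add, map_pow, hg, invol_C, invol_C, pow_one, mul_pow]
    ring
  rw [hι]
  exact Submodule.add_mem_sup (Ideal.mul_mem_left _ _ (Ideal.mem_span_singleton_self _))
    (Ideal.mul_mem_left _ _ (Ideal.mem_span_singleton_self _))

/-- **The involution `ι₁` of `A_{m,1}` induced by `ι`** exists: a ring endomorphism with `ι₁ [G] = [ι G]`.
[cite: MazurTateTeitelbaum1986Invent, Ch. I §17] [cite: Howard2004HeegnerKolyvagin, §3.2 (the involution ι of Λ, T_𝔭 vs T_{𝔭^ι})] -/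
theorem exists_ringHom_mk_eq_mk_invol (m : ℕ) :
    ∃ ι₁ : EisensteinCoeff p m 1 →+* EisensteinCoeff p m 1,
      ∀ G : IwasawaAlgebra p, ι₁ (Ideal.Quotient.mk _ G) = Ideal.Quotient.mk _ (invol p G) :=
  ⟨Ideal.Quotient.lift _ ((Ideal.Quotient.mk _).comp (invol p).toRingHom) fun a ha ↦ by
      rw [RingHom.comp_apply, Ideal.Quotient.eq_zero_iff_mem]
      exact invol_mem_of_mem p m ha,
    fun G ↦ Ideal.Quotient.lift_mk _ _ _⟩

variable {p} {m : ℕ} {ι₁ : EisensteinCoeff p m 1 →+* EisensteinCoeff p m 1}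
  (hι : ∀ G : IwasawaAlgebra p, ι₁ (Ideal.Quotient.mk _ G) = Ideal.Quotient.mk _ (invol p G))
include hι

/-- `ι₁` is an involution. [cite: MazurTateTeitelbaum1986Invent, Ch. I §17] -/
theorem invol₁_invol₁ (c : EisensteinCoeff p m 1) : ι₁ (ι₁ c) = c := by
  obtain ⟨G, rfl⟩ := Ideal.Quotient.mk_surjective c
  rw [hι, hι, invol_invol]

/-- `ι₁ (1 + T) · (1 + T) = 1`: `ι₁` inverts the value `ψ(γ) = 1 + T` (inversion on `Γ`).
[cite: MazurTateTeitelbaum1986Invent, Ch. I §17] [cite: Howard2004HeegnerKolyvagin, §2.2 (Γ_K acts on Λ through γ ↦ 1 + T)] -/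
theorem invol₁_onePlusT_mul_onePlusT : ι₁ (onePlusT p m 1) * onePlusT p m 1 = 1 := by
  rw [onePlusT_def, hι, ← map_mul, mul_comm, one_add_X_mul_invol_one_add_X, map_one]

/-- **`ι₁[T]^{m-1} = (−1)^{m-1} [T]^{m-1}` in `A_{m,1}`** (`ι T = −T (1 + ι T)` and `[T]^m = 0`).
[cite: MazurTateTeitelbaum1986Invent, Ch. I §17] [cite: Howard2004HeegnerKolyvagin, proof of Thm. 2.2.10] -/
theorem invol₁_mk_X_pow_pred (hm : 1 ≤ m) :
    ι₁ (Ideal.Quotient.mk _ PowerSeries.X) ^ (m - 1) =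
      (-1) ^ (m - 1) * (Ideal.Quotient.mk _ PowerSeries.X : EisensteinCoeff p m 1) ^ (m - 1) := by
  set X₁ : EisensteinCoeff p m 1 := Ideal.Quotient.mk _ PowerSeries.X with hX₁
  set y : EisensteinCoeff p m 1 := ι₁ X₁ with hy
  -- `y (1 + X₁) = -X₁`, so `y = X₁ * (-(1 + y))`
  have h1 : y * (1 + X₁) = -X₁ := by
    rw [hy, hX₁, hι, ← map_one (Ideal.Quotient.mk _), ← map_add, ← map_mul, invol_X_mul_one_add_X, map_neg]
  have h2 : y = X₁ * (-(1 + y)) := by linear_combination h1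
  -- `(-(1+y))^{m-1} = (-1)^{m-1} (1 + y q)`
  obtain ⟨q, hq⟩ := exists_one_add_pow_eq y (m - 1)
  have h3 : X₁ ^ (m - 1) * y = 0 := by
    rw [h2, ← mul_assoc, mk_X_pow_pred_mul_mk_X p hm, zero_mul]
  calc y ^ (m - 1) = (X₁ * (-(1 + y))) ^ (m - 1) := by rw [← h2]
    _ = (-1) ^ (m - 1) * X₁ ^ (m - 1) * (1 + y) ^ (m - 1) := by rw [mul_pow, neg_eq_neg_one_mul, mul_pow]; ring
    _ = (-1) ^ (m - 1) * X₁ ^ (m - 1) + (-1) ^ (m - 1) * (X₁ ^ (m - 1) * y) * ((m - 1 : ℕ) + y * q) := by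
        rw [hq]; ring
    _ = (-1) ^ (m - 1) * X₁ ^ (m - 1) := by rw [h3]; ring

/-- `ι₁` preserves the residue character: `ε (ι₁ c) = ε c` (`ι` fixes constant terms; `ε(ι₁[T]) = 0`).
[cite: Howard2004HeegnerKolyvagin, proof of Prop. 2.1.3 (S_𝔭/𝔪)] [cite: MazurTateTeitelbaum1986Invent, Ch. I §17] -/
theorem residueChar_invol₁ (hm : 1 ≤ m) (c : EisensteinCoeff p m 1) :
    residueChar p hm (le_refl 1) (ι₁ c) = residueChar p hm (le_refl 1) c := by
  obtain ⟨G, rfl⟩ := Ideal.Quotient.mk_surjective c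
  have hG : G = PowerSeries.X * PowerSeries.mk (fun n ↦ PowerSeries.coeff (n + 1) G) +
      PowerSeries.C (PowerSeries.constantCoeff G) := by
    rw [← PowerSeries.eq_X_mul_shift_add_const]
  have hιX : residueChar p hm (le_refl 1) (ι₁ (Ideal.Quotient.mk _ PowerSeries.X)) = 0 := by
    have h1 : ι₁ (Ideal.Quotient.mk _ PowerSeries.X) * (1 + Ideal.Quotient.mk _ PowerSeries.X) =
        -Ideal.Quotient.mk _ PowerSeries.X := by
      rw [hι, ← map_one (Ideal.Quotient.mk _), ← map_add, ← map_mul, invol_X_mul_one_add_X, map_neg]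
    have h2 := congrArg (residueChar p hm (le_refl 1)) h1
    rw [map_mul, map_add, map_one, map_neg, residueChar_mk_X, add_zero, mul_one, neg_zero] at h2
    exact h2
  set H : IwasawaAlgebra p := PowerSeries.mk (fun n ↦ PowerSeries.coeff (n + 1) G) with hH
  have eL : ι₁ (Ideal.Quotient.mk _ G) = ι₁ (Ideal.Quotient.mk _ PowerSeries.X) * ι₁ (Ideal.Quotient.mk _ H) +
      Ideal.Quotient.mk _ (PowerSeries.C (PowerSeries.constantCoeff G)) := by
    conv_lhs => rw [hG]
    rw [map_add (Ideal.Quotient.mk _), map_mul (Ideal.Quotient.mk _), map_add ι₁, map_mul ι₁,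
      hι (PowerSeries.C _), invol_C]
  have eR : (Ideal.Quotient.mk _ G : EisensteinCoeff p m 1) =
      Ideal.Quotient.mk _ PowerSeries.X * Ideal.Quotient.mk _ H + Ideal.Quotient.mk _ (PowerSeries.C (PowerSeries.constantCoeff G)) := by
    conv_lhs => rw [hG]
    rw [map_add (Ideal.Quotient.mk _), map_mul (Ideal.Quotient.mk _)]
  rw [eL, eR, map_add (residueChar p hm (le_refl 1)), map_mul (residueChar p hm (le_refl 1)), hιX, zero_mul, zero_add,
    map_add (residueChar p hm (le_refl 1)), map_mul (residueChar p hm (le_refl 1)), residueChar_mk_X, zero_mul, zero_add]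

/-- From `u^{e} · u^{e'} = 1` (`u = 1 + T`): `(ι₁ u)^{e'} = u^{e}` — the unipotent factors of the twisted action and of
its `τ`-conjugate match under `ι₁` (opposite exponents, anticyclotomic `κ`). [cite: Howard2004HeegnerKolyvagin, §2.2 (anticyclotomic character)] -/
theorem invol₁_onePlusT_pow_eq {e e' : ℕ} (h : onePlusT p m 1 ^ e * onePlusT p m 1 ^ e' = 1) :
    ι₁ (onePlusT p m 1) ^ e' = onePlusT p m 1 ^ e := by
  have h1 : ι₁ (onePlusT p m 1) ^ e' * onePlusT p m 1 ^ e' = 1 := by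
    rw [← mul_pow, invol₁_onePlusT_mul_onePlusT hι, one_pow]
  calc ι₁ (onePlusT p m 1) ^ e' = ι₁ (onePlusT p m 1) ^ e' * (onePlusT p m 1 ^ e * onePlusT p m 1 ^ e') := by
        rw [h, mul_one]
    _ = onePlusT p m 1 ^ e * (ι₁ (onePlusT p m 1) ^ e' * onePlusT p m 1 ^ e') := by ring
    _ = onePlusT p m 1 ^ e := by rw [h1, mul_one]

end IwasawaAlgebra.EisensteinCoeff

/-! ## §4 The `G_ℚ`-structure `Θ = (−1)^{m-1} (ι ⊗ θ)` of the bottom level `M ⊗ A_{m,1}(ψ)` -/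

namespace ZpExtension

open Literature.NumberTheory.GaloisRepresentations Field IwasawaAlgebra

variable {K : Type} [Field K] {p : ℕ} [hp : Fact p.Prime] (κ : ZpExtension K p) {m : ℕ} (hm : 1 ≤ m)
  {M : Type} [AddCommGroup M] [TopologicalSpace M] [DiscreteTopology M] (ρ : DiscreteGaloisModule K M)

/-- **The `G_ℚ`-structure of the bottom Eisenstein level.**  For `κ` anticyclotomic with respect to a map `c` of
`Γ_K` (`κ(c g) = −κ(g)`; `c` = conjugation by a complex conjugation) and an additive `θ : M → M` with
`θ ∘ ρ(c g) = ρ(g) ∘ θ`, there are a ring endomorphism `ι₁` of `A_{m,1}` lifting the Iwasawa involution and an additive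
`Θ` of `M ⊗ A_{m,1}` with `Θ (d ⊗ a) = (−1)^{m-1} · ι₁ d ⊗ θ a`, such that: `Θ` intertwines the `c`-conjugate of the
twisted action `eisensteinTwist ρ hm 1` with the twisted action; `Θ` is an involution if `θ` is; `Θ ([T]^{m-1} • x) =
(−1)^{m-1} [T]^{m-1} • Θ x`; and `ι₁` preserves the residue character.  (This is what replaces, on `T_𝔮/p`, the
`G_ℚ`-action that `T_𝔮 = T_p E ⊗ Λ/𝔮 (ψ)` lacks: `Tw(T_𝔮) ≅ T_{ι𝔮}`, but `ι` acts on `Λ/(𝔮, p) = 𝔽_p[T]/(T^m)`.)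
[cite: Howard2004HeegnerKolyvagin, §1.3 H.5 (arXiv:1202.6340 p. 7 L93–97, p. 7 L108–113) and §3.2 (ψ : T_𝔭 → T_{𝔭^ι})]
[cite: MazurTateTeitelbaum1986Invent, Ch. I §17] -/
theorem exists_bottomConj (c : absoluteGaloisGroup K → absoluteGaloisGroup K)
    (hanti : ∀ g : absoluteGaloisGroup K, (κ (c g)).toAdd = -(κ g).toAdd)
    (θ : M →+ M) (hθ : ∀ (g : absoluteGaloisGroup K) (a : M), θ (ρ (c g) a) = ρ g (θ a)) :
    ∃ (ι₁ : EisensteinCoeff p m 1 →+* EisensteinCoeff p m 1)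
      (Θ : EisensteinCoeff.Twisted p m 1 M →+ EisensteinCoeff.Twisted p m 1 M),
      (∀ G : IwasawaAlgebra p, ι₁ (Ideal.Quotient.mk _ G) = Ideal.Quotient.mk _ (invol p G)) ∧
      (∀ (d : EisensteinCoeff p m 1) (a : M), Θ (EisensteinCoeff.Twisted.tmul d a) =
        ((-1 : ℤ) ^ (m - 1)) • EisensteinCoeff.Twisted.tmul (ι₁ d) (θ a)) ∧
      (∀ (g : absoluteGaloisGroup K) (x : EisensteinCoeff.Twisted p m 1 M),
        Θ (κ.eisensteinTwist ρ hm 1 (c g) x) = κ.eisensteinTwist ρ hm 1 g (Θ x)) ∧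
      ((∀ a, θ (θ a) = a) → ∀ x, Θ (Θ x) = x) ∧
      (∀ x : EisensteinCoeff.Twisted p m 1 M,
        Θ (((Ideal.Quotient.mk _ PowerSeries.X : EisensteinCoeff p m 1) ^ (m - 1)) • x) =
          ((-1 : ℤ) ^ (m - 1)) • (((Ideal.Quotient.mk _ PowerSeries.X : EisensteinCoeff p m 1) ^ (m - 1)) • Θ x)) ∧
      (∀ d, EisensteinCoeff.residueChar p hm (le_refl 1) (ι₁ d) = EisensteinCoeff.residueChar p hm (le_refl 1) d) := by
  obtain ⟨ι₁, hι⟩ := EisensteinCoeff.exists_ringHom_mk_eq_mk_invol p m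
  -- `Θ₀ = ι₁ ⊗ θ` on the carrier `A_{m,1} ⊗_ℤ M`, then the sign
  let Θ₀ : EisensteinCoeff.Twisted p m 1 M →+ EisensteinCoeff.Twisted p m 1 M :=
    (TensorProduct.map ι₁.toAddMonoidHom.toIntLinearMap θ.toIntLinearMap).toAddMonoidHom
  have hΘ₀ : ∀ (d : EisensteinCoeff p m 1) (a : M),
      Θ₀ (EisensteinCoeff.Twisted.tmul d a) = EisensteinCoeff.Twisted.tmul (ι₁ d) (θ a) := fun d a ↦
    TensorProduct.map_tmul _ _ d a
  let Θ : EisensteinCoeff.Twisted p m 1 M →+ EisensteinCoeff.Twisted p m 1 M := ((-1 : ℤ) ^ (m - 1)) • Θ₀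
  have hΘ : ∀ (d : EisensteinCoeff p m 1) (a : M), Θ (EisensteinCoeff.Twisted.tmul d a) =
      ((-1 : ℤ) ^ (m - 1)) • EisensteinCoeff.Twisted.tmul (ι₁ d) (θ a) := fun d a ↦ by
    change ((-1 : ℤ) ^ (m - 1)) • Θ₀ (EisensteinCoeff.Twisted.tmul d a) = _
    rw [hΘ₀]
  -- `Θ₀` is `ι₁`-semilinear
  have hΘ₀s : ∀ (d : EisensteinCoeff p m 1) (x : EisensteinCoeff.Twisted p m 1 M), Θ₀ (d • x) = ι₁ d • Θ₀ x := by
    intro d x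
    induction x using EisensteinCoeff.Twisted.induction_on with
    | zero => rw [smul_zero, map_zero, smul_zero]
    | tmul d' a => rw [EisensteinCoeff.Twisted.smul_tmul, hΘ₀, hΘ₀, map_mul, EisensteinCoeff.Twisted.smul_tmul]
    | add x y hx hy => rw [smul_add, map_add, hx, hy, map_add, smul_add]
  have hΘs : ∀ (d : EisensteinCoeff p m 1) (x : EisensteinCoeff.Twisted p m 1 M), Θ (d • x) = ι₁ d • Θ x := by
    intro d x
    change ((-1 : ℤ) ^ (m - 1)) • Θ₀ (d • x) = ι₁ d • (((-1 : ℤ) ^ (m - 1)) • Θ₀ x)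
    rw [hΘ₀s, smul_comm]
  refine ⟨ι₁, Θ, hι, hΘ, fun g x ↦ ?_, fun hθθ x ↦ ?_, fun x ↦ ?_,
    fun d ↦ EisensteinCoeff.residueChar_invol₁ hι hm d⟩
  · -- `c`-equivariance: on pure tensors the unipotent factors match by anticyclotomicity
    have hu : ι₁ (EisensteinCoeff.onePlusT p m 1) ^ κ.twistExponent (eisensteinLevel (p := p) hm 1) (c g) =
        EisensteinCoeff.onePlusT p m 1 ^ κ.twistExponent (eisensteinLevel (p := p) hm 1) g := by
      refine EisensteinCoeff.invol₁_onePlusT_pow_eq hι ?_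
      obtain ⟨n, hn⟩ := twistExponent_add_twistExponent_conj_dvd κ c hanti (eisensteinLevel (p := p) hm 1) g
      rw [← pow_add, hn, pow_mul, onePlusT_pow_prime_pow_eisensteinLevel, one_pow]
    induction x using EisensteinCoeff.Twisted.induction_on with
    | zero => rw [map_zero, map_zero, map_zero]
    | tmul d a =>
      rw [eisensteinTwist_apply_tmul, hΘ, hΘ, map_zsmul, eisensteinTwist_apply_tmul, map_mul ι₁, map_pow ι₁, hu, hθ]
    | add x y hx hy => rw [map_add, map_add, hx, hy, map_add, map_add]
  · -- involutivity
    induction x using EisensteinCoeff.Twisted.induction_on with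
    | zero => rw [map_zero, map_zero]
    | tmul d a =>
      rw [hΘ, map_zsmul, hΘ, EisensteinCoeff.invol₁_invol₁ hι, hθθ, smul_smul, ← pow_add, ← two_mul, pow_mul,
        neg_one_sq, one_pow, one_smul]
    | add x y hx hy => rw [map_add, map_add, hx, hy]
  · -- the top graded piece
    rw [hΘs, map_pow ι₁, EisensteinCoeff.invol₁_mk_X_pow_pred hι hm, mul_smul, ← Int.cast_smul_eq_zsmul
      (EisensteinCoeff p m 1) ((-1 : ℤ) ^ (m - 1)), smul_smul, smul_smul, Int.cast_pow, Int.cast_neg, Int.cast_one,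
      mul_comm]

end ZpExtension


end Literature.NumberTheory.EllipticCurves

end
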